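import Summits.NavierStokesRegularity.FluidComputer.ForcedContinuationPieces
import Literature.Analysis.FluidPDE.ClassicalContinuationAPriori
import Literature.Analysis.FluidPDE.ClassicalSolutionGlueIcc
import Literature.Analysis.FluidPDE.TaoH1LocalExistenceForced
import HarnessLib

/-!
# Crossing the end of a forced era, III: the HALF-OPEN slab — a classical finite-energy solution of
# the FORCED system on `[0, τ)` that stays BOUNDED extends classically past `τ` (the `L^∞` blow-up
# criterion for Clay data), given Tao's forced local theory

Cell `ns-blowup`, seat `ns-blowup-ecbridge-1` (g5); asked for by `ns-blowup-ecbridge-2` (g4, MEMO-3):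
the generic E–C object `DesignedBlowup ν` is a classical solution on a HALF-OPEN slab `[0, T)`, so the
closed-slab theorem `ForcedContinuation.exists_forced_continuation_of_bounded` (file II) does not apply
to it verbatim. LABEL: E–C typing + kernel analysis. WHAT THIS IS NOT: not Navier–Stokes evidence — a
CONDITIONAL continuation / blow-up criterion (one named fact,
`Literature.Analysis.FluidPDE.tao2011_smooth_local_existence_forced` = Tao 2013 Thm. 5.4 (ii)+(iv)
WITH forcing); nothing is constructed.

* `ForcedContinuation.exists_forced_extension_of_bounded_Ico` — `ν > 0`, Clay-class force `f`,
  `(u, p)` classical on `[0, τ)`, `τ > 0`, with the energy AND the velocity bounded uniformly on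
  `[0, τ)` (`∫|u(t)|² ≤ E₀ < ∞`, `‖u‖ ≤ M`) and Schwartz datum `u 0`: there are `T' > τ` and a
  classical finite-energy `(U, P)` on the CLOSED slab `[0, T']` with the same force and `U = u` on
  `[0, τ)` (velocity; the pressure agrees on an initial segment only — the gauge of `p` near `τ` is
  not controlled). Same RESTART LOOP as file II, never reading `u(τ)`: pieces from the `H^∞` slices
  `u(n h/2)` with the uniform lifespan `h`, identified with the flow on the closed sub-slab
  `[t_n, t_n + 3h/4] ⊂ [0, τ)` (W14-free uniqueness), enstrophy marched by the forced
  Serrin–Grönwall inequality at `r = ∞` on that sub-slab; the first piece with `t_N + h > τ`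
  (`t_N + h/2 ≤ τ`) is glued to `u` along `(t_N, t_N + h/4)`, so `T' = t_N + h > τ` strictly.
* `ForcedContinuation.hasSmoothExtensionPast_of_bounded` — the same, packaged as
  `HasSmoothExtensionPast ν f u τ`.
* `ForcedContinuation.velocity_unbounded_of_maximal` — **the `L^∞` blow-up criterion WITH a Clay
  force, modulo F2**: a maximal classical solution on `[0, T)` (`IsMaximalSmoothSolution`) with
  Schwartz datum, Clay force and bounded energy on `[0, T)` has UNBOUNDED velocity on `[0, T) × ℝ³`
  (Leray 1934 / Lemarié-Rieusset 2016 Thm. 11.2 at `r = ∞`, here for classical Clay-class solutions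
  of the forced system).

References: T. Tao, Anal. PDE 6 (2013), Thm. 5.4 [cite: Tao2011, Thm. 5.4 (ii)+(iv)];
P. G. Lemarié-Rieusset, CRC 2016, Thm. 11.2 [cite: LemarieRieusset2016, Thm. 11.2 (11.11)];
J. T. Beale, T. Kato, A. Majda, Comm. Math. Phys. 94 (1984) §1 (maximal interval of smooth
existence) [cite: BealeKatoMajda1984, §1].
-/

noncomputable section

open MeasureTheory Set Function Filter Topology
open scoped ENNReal NNReal ContDiff

namespace Summit.NavierStokesRegularity.FluidComputer.PalasekTowerClayBridge

open Literature.Analysis.FluidPDE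

namespace ForcedContinuation

/-- The energy of a field is the `L²` norm of its `0`-th derivative (private copy of a tree lemma).
[folklore] -/
private theorem lintegral_enorm_sq_eq_iteratedFDeriv_zero'
    (v : EuclideanSpace ℝ (Fin 3) → EuclideanSpace ℝ (Fin 3)) :
    ∫⁻ x, ‖v x‖ₑ ^ 2 = ∫⁻ x, ‖iteratedFDeriv ℝ 0 v x‖ₑ ^ 2 :=
  lintegral_congr fun x => by rw [← ofReal_norm, ← ofReal_norm, norm_iteratedFDeriv_zero]

section HalfOpen

variable {ν τ M : ℝ} {f u : ℝ → EuclideanSpace ℝ (Fin 3) → EuclideanSpace ℝ (Fin 3)}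
  {p : ℝ → EuclideanSpace ℝ (Fin 3) → ℝ}

/-- **The last restarted piece** (bookkeeping half of `exists_forced_extension_of_bounded_Ico`):
under the hypotheses of that theorem there are a lifespan `h > 0`, a restart time `t_N ≥ 0` with
`t_N + h/2 ≤ τ < t_N + h`, and a Tao-class piece `(w, q)` on `[0, h]` under the shifted force from the
slice `u t_N` (restart loop of file II run on closed sub-slabs of `[0, τ)`).
[cite: Tao2011, Thm. 5.4 (ii)+(iv)] [cite: LemarieRieusset2016, Thm. 11.2 (11.11)] -/
theorem exists_last_piece_Ico (hF : tao2011_smooth_local_existence_forced)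
    (hν : 0 < ν) (hτ : 0 < τ) (hs : IsSmoothOnHalfSpace f) (hd : HasRapidSpaceTimeDecay f)
    (hu : IsClassicalNSSolutionOn (Ico 0 τ) ν f u p)
    (hE : ∃ C : ℝ≥0∞, C < ⊤ ∧ ∀ t ∈ Ico 0 τ, ∫⁻ x, ‖u t x‖ₑ ^ 2 ≤ C)
    (hM : ∀ t ∈ Ico 0 τ, ∀ x, ‖u t x‖ ≤ M) (h0 : HasRapidSpatialDecay (u 0)) :
    ∃ (h tN : ℝ) (w : ℝ → EuclideanSpace ℝ (Fin 3) → EuclideanSpace ℝ (Fin 3))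
      (q : ℝ → EuclideanSpace ℝ (Fin 3) → ℝ),
      0 < h ∧ 0 ≤ tN ∧ tN + h / 2 ≤ τ ∧ τ < tN + h ∧
      IsClassicalNSSolutionOn (Icc 0 h) ν (fun s => f (s + tN)) w q ∧ w 0 = u tN ∧
      HasBoundedSobolevNormsOn (Icc 0 h) w ∧
      (∃ C : ℝ≥0∞, C < ⊤ ∧ ∀ t ∈ Icc 0 h, ∫⁻ x, ‖w t x‖ₑ ^ 2 ≤ C) := by
  classical
  obtain ⟨c, hc, hloc⟩ := hF
  obtain ⟨C₀, C₁, B, hB0, hC₀, hC₁, hBf⟩ := exists_force_slice_bounds hs hd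
  obtain ⟨E₀, hE₀, hEb⟩ := hE
  have hM0 : 0 ≤ M := le_trans (norm_nonneg _) (hM 0 ⟨le_rfl, hτ⟩ 0)
  -- closed sub-slabs
  have huc : ∀ τ₁, 0 < τ₁ → τ₁ < τ → IsClassicalNSSolutionOn (Icc 0 τ₁) ν f u p := fun τ₁ h₁ h₂ =>
    hu.mono (fun t ht => ⟨ht.1, lt_of_le_of_lt ht.2 h₂⟩) (uniqueDiffOn_Icc h₁)
  have hEc : ∀ τ₁, τ₁ < τ → ∃ C : ℝ≥0∞, C < ⊤ ∧ ∀ t ∈ Icc 0 τ₁, ∫⁻ x, ‖u t x‖ₑ ^ 2 ≤ C :=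
    fun τ₁ h₂ => ⟨E₀, hE₀, fun t ht => hEb t ⟨ht.1, lt_of_le_of_lt ht.2 h₂⟩⟩
  have hMc : ∀ τ₁, τ₁ < τ → ∀ t ∈ Icc 0 τ₁, ∀ x, ‖u t x‖ ≤ M :=
    fun τ₁ h₂ t ht x => hM t ⟨ht.1, lt_of_le_of_lt ht.2 h₂⟩ x
  -- the Serrin–Grönwall rate at `θ = 1`
  set κ : ℝ := 2 * ((1 : ℝ) * (2 * (1 - (1 : ℝ))) ^ ((1 - (1 : ℝ)) / 1) * (2 : ℝ) ^ (-(1 / (1 : ℝ))) *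
      (SNormLESNormFDerivOfEqConst (EuclideanSpace ℝ (Fin 3))
        (volume : Measure (EuclideanSpace ℝ (Fin 3))) 2 : ℝ) ^ (2 * (1 - (1 : ℝ)) / 1)) *
      (ν / 2) ^ (1 - 2 / (1 : ℝ)) with hκ
  have hκ0 : 0 ≤ κ := by
    have h0' : (0 : ℝ) ≤ (2 * (1 - (1 : ℝ))) ^ ((1 - (1 : ℝ)) / 1) := Real.rpow_nonneg (by norm_num) _
    have h1' : (0 : ℝ) ≤ (2 : ℝ) ^ (-(1 / (1 : ℝ))) := Real.rpow_nonneg (by norm_num) _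
    have h2' : (0 : ℝ) ≤ (SNormLESNormFDerivOfEqConst (EuclideanSpace ℝ (Fin 3))
        (volume : Measure (EuclideanSpace ℝ (Fin 3))) 2 : ℝ) ^ (2 * (1 - (1 : ℝ)) / 1) :=
      Real.rpow_nonneg (NNReal.coe_nonneg _) _
    have h3' : (0 : ℝ) ≤ (ν / 2) ^ (1 - 2 / (1 : ℝ)) := Real.rpow_nonneg (by positivity) _
    positivity
  -- initial enstrophy and the uniform enstrophy bound
  set K₀ : ℝ≥0∞ := ∫⁻ x, ENNReal.ofReal (frobeniusNormSq (fderiv ℝ (u 0) x)) with hK₀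
  have hK₀t : K₀ < ⊤ :=
    (lintegral_frobeniusNormSq_le_three_mul_iteratedFDeriv_one (u 0)).trans_lt
      (ENNReal.mul_lt_top (by simp) (h0.lintegral_enorm_iteratedFDeriv_sq_lt_top 1))
  set KS : ℝ≥0∞ := ENNReal.ofReal (Real.exp (κ * (M ^ 2 * (2 * τ)))) *
      (K₀ + (ENNReal.ofReal ν)⁻¹ * ((C₀ : ℝ≥0∞) * ENNReal.ofReal (2 * τ))) with hKS
  have hKSt : KS < ⊤ := by
    refine ENNReal.mul_lt_top ENNReal.ofReal_lt_top (ENNReal.add_lt_top.2 ⟨hK₀t, ?_⟩)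
    refine ENNReal.mul_lt_top ?_ (ENNReal.mul_lt_top ENNReal.coe_lt_top ENNReal.ofReal_lt_top)
    exact ENNReal.inv_lt_top.2 (ENNReal.ofReal_pos.2 hν)
  -- the uniform `H¹` radius `A` and the uniform lifespan `h`
  set A : ℝ := Real.sqrt (E₀ + KS).toReal with hA
  have hA0 : 0 ≤ A := Real.sqrt_nonneg _
  have hA2 : ENNReal.ofReal (A ^ 2) = E₀ + KS := by
    rw [hA, Real.sq_sqrt ENNReal.toReal_nonneg, ENNReal.ofReal_toReal]
    exact (ENNReal.add_lt_top.2 ⟨hE₀, hKSt⟩).ne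
  set h : ℝ := min τ (min 1 (c * ν ^ 3 / (A + B + 1) ^ 4)) with hh
  have hhτ : h ≤ τ := min_le_left _ _
  have hh1 : h ≤ 1 := (min_le_right _ _).trans (min_le_left _ _)
  have hhc : h ≤ c * ν ^ 3 / (A + B + 1) ^ 4 := (min_le_right _ _).trans (min_le_right _ _)
  have hhpos : 0 < h := lt_min hτ (lt_min one_pos (by positivity))
  have hsmall : (A + B * h) ^ 4 * h ≤ c * ν ^ 3 := by
    have h1 : A + B * h ≤ A + B + 1 := by nlinarith
    have h2 : 0 ≤ A + B * h := by positivity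
    calc (A + B * h) ^ 4 * h ≤ (A + B + 1) ^ 4 * h :=
          mul_le_mul_of_nonneg_right (pow_le_pow_left₀ h2 h1 4) hhpos.le
      _ ≤ (A + B + 1) ^ 4 * (c * ν ^ 3 / (A + B + 1) ^ 4) :=
          mul_le_mul_of_nonneg_left hhc (by positivity)
      _ = c * ν ^ 3 := by field_simp
  -- ONE PIECE from a good slice `u t₀`
  have piece : ∀ t₀, 0 ≤ t₀ → t₀ < τ → (∀ m : ℕ, ∫⁻ x, ‖iteratedFDeriv ℝ m (u t₀) x‖ₑ ^ 2 < ⊤) →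
      (∫⁻ x, ENNReal.ofReal (frobeniusNormSq (fderiv ℝ (u t₀) x))) ≤ KS →
      ∃ (w : ℝ → EuclideanSpace ℝ (Fin 3) → EuclideanSpace ℝ (Fin 3))
        (q : ℝ → EuclideanSpace ℝ (Fin 3) → ℝ),
        IsClassicalNSSolutionOn (Icc 0 h) ν (fun s => f (s + t₀)) w q ∧ w 0 = u t₀ ∧
        HasBoundedSobolevNormsOn (Icc 0 h) w ∧
        HasBoundedSobolevNormsOn (Icc 0 h) (timeDerivWithin (Icc 0 h) w) ∧
        (∀ n : ℕ, ∃ C : ℝ≥0, ∀ t ∈ Icc 0 h, ∫⁻ x, ‖iteratedFDeriv ℝ n (q t) x‖ₑ ^ 2 ≤ C) := by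
    intro t₀ ht₀ ht₀τ hHinf hens
    have hdat : (∫⁻ x, ‖u t₀ x‖ₑ ^ 2) +
        (∫⁻ x, ENNReal.ofReal (frobeniusNormSq (fderiv ℝ (u t₀) x))) ≤ ENNReal.ofReal (A ^ 2) := by
      rw [hA2]; exact add_le_add (hEb t₀ ⟨ht₀, ht₀τ⟩) hens
    have hfB : ∀ t ∈ Icc 0 h, (∫⁻ x, ‖(fun s => f (s + t₀)) t x‖ₑ ^ 2) +
        (∫⁻ x, ENNReal.ofReal (frobeniusNormSq (fderiv ℝ ((fun s => f (s + t₀)) t) x))) ≤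
          ENNReal.ofReal (B ^ 2) := fun t ht => hBf (t + t₀) (by linarith [ht.1])
    obtain ⟨w, q, hw, hw0, hwS, hwS', hqS, -⟩ := hloc hν hhpos (hu.contDiff_velocity ⟨ht₀, ht₀τ⟩)
      (hu.divFree t₀ ⟨ht₀, ht₀τ⟩) hHinf (hs.isSmoothSpaceTimeOn_Icc_timeShift ht₀ h)
      (hd.hasUniformRapidDecayOn_Icc_timeShift hs ht₀ hhpos) hA0 hB0 hdat hfB hsmall
    exact ⟨w, q, hw, hw0, hwS, hwS', hqS⟩
  -- energy of a Tao-class piece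
  have pieceE : ∀ {w : ℝ → EuclideanSpace ℝ (Fin 3) → EuclideanSpace ℝ (Fin 3)},
      HasBoundedSobolevNormsOn (Icc 0 h) w →
      ∃ C : ℝ≥0∞, C < ⊤ ∧ ∀ t ∈ Icc 0 h, ∫⁻ x, ‖w t x‖ₑ ^ 2 ≤ C := by
    intro w hwS
    obtain ⟨C, hC⟩ := hwS 0
    exact ⟨C, ENNReal.coe_lt_top, fun t ht => by
      rw [lintegral_enorm_sq_eq_iteratedFDeriv_zero']; exact hC t ht⟩
  -- THE LOOP: the slices `u (n h/2)` are `H^∞` with controlled enstrophy while `n h/2 + h/2 ≤ τ`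
  set bE : ℝ≥0∞ := (ENNReal.ofReal ν)⁻¹ * ((C₀ : ℝ≥0∞) * ENNReal.ofReal h) with hbE
  have loop : ∀ n : ℕ, (n : ℝ) * (h / 2) + h / 2 ≤ τ →
      (∀ m : ℕ, ∫⁻ x, ‖iteratedFDeriv ℝ m (u ((n : ℝ) * (h / 2))) x‖ₑ ^ 2 < ⊤) ∧
      (∫⁻ x, ENNReal.ofReal (frobeniusNormSq (fderiv ℝ (u ((n : ℝ) * (h / 2))) x))) ≤
        ENNReal.ofReal (Real.exp (κ * (M ^ 2 * ((n : ℝ) * h)))) * (K₀ + (n : ℝ≥0∞) * bE) := by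
    intro n
    induction n with
    | zero =>
      intro _
      refine ⟨fun m => ?_, ?_⟩
      · simpa using h0.lintegral_enorm_iteratedFDeriv_sq_lt_top (μ := (volume : Measure _)) m
      · simp [hK₀]
    | succ n ih =>
      intro hn1
      have htn : (n : ℝ) * (h / 2) + h ≤ τ := by push_cast at hn1; linarith
      have htn0 : 0 ≤ (n : ℝ) * (h / 2) := by positivity
      obtain ⟨hH, hens⟩ := ih (by linarith)
      have hnh : (n : ℝ) * h ≤ 2 * τ := by linarith
      have hensKS : (∫⁻ x, ENNReal.ofReal (frobeniusNormSq (fderiv ℝ (u ((n : ℝ) * (h / 2))) x))) ≤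
          KS := hens.trans (loop_bound_le_uniform hκ0 K₀ C₀ n hnh)
      obtain ⟨w, q, hw, hw0, hwS, hwS', hqS⟩ := piece _ htn0 (by linarith) hH hensKS
      -- the piece is the flow on `[0, 3h/4]` (a closed slab inside `[0, τ)`)
      have h34 : (n : ℝ) * (h / 2) + 3 * h / 4 < τ := by linarith
      have heq : ∀ s ∈ Icc 0 (3 * h / 4), w s = u (s + (n : ℝ) * (h / 2)) :=
        piece_eq_shift hν hs hd (huc _ (by linarith) h34) (hEc _ h34) (hMc _ h34) htn0 (by linarith)
          le_rfl (by linarith) hw (pieceE hwS) hw0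
      have hw34 : IsClassicalNSSolutionOn (Icc 0 (3 * h / 4)) ν (fun s => f (s + (n : ℝ) * (h / 2))) w q :=
        hw.mono (Icc_subset_Icc le_rfl (by linarith)) (uniqueDiffOn_Icc (by linarith))
      have hwS34 : HasBoundedSobolevNormsOn (Icc 0 (3 * h / 4)) w :=
        hwS.mono (Icc_subset_Icc le_rfl (by linarith))
      have hwS'34 : HasBoundedSobolevNormsOn (Icc 0 (3 * h / 4)) (timeDerivWithin (Icc 0 (3 * h / 4)) w) := by
        intro m'
        obtain ⟨C, hC⟩ := hwS' m'
        refine ⟨C, fun t ht => ?_⟩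
        rw [timeDerivWithin_sub_slab hw.smooth_velocity (by linarith) (by linarith) ht]
        exact hC t ⟨ht.1, by linarith [ht.2]⟩
      have hqS34 : ∀ m' : ℕ, ∃ C : ℝ≥0, ∀ t ∈ Icc 0 (3 * h / 4),
          ∫⁻ x, ‖iteratedFDeriv ℝ m' (q t) x‖ₑ ^ 2 ≤ C := fun m' => by
        obtain ⟨C, hC⟩ := hqS m'
        exact ⟨C, fun t ht => hC t ⟨ht.1, by linarith [ht.2]⟩⟩
      have hwM : ∀ t ∈ Icc 0 (3 * h / 4), ∀ x, ‖w t x‖ ≤ M := fun t ht x => by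
        rw [heq t ht]; exact hM _ ⟨by linarith [ht.1], by linarith [ht.2]⟩ x
      have hG34 := piece_enstrophy_le hν hC₀ hC₁ htn0 (by linarith : 0 < 3 * h / 4) hM0 hw34 hwS34
        hwS'34 hqS34 hwM (h / 2) ⟨by linarith, by linarith⟩
      have hG : (∫⁻ x, ENNReal.ofReal (frobeniusNormSq (fderiv ℝ (w (h / 2)) x))) ≤
          ENNReal.ofReal (Real.exp (κ * (M ^ 2 * h))) *
            ((∫⁻ x, ENNReal.ofReal (frobeniusNormSq (fderiv ℝ (w 0) x))) +
              (ENNReal.ofReal ν)⁻¹ * ((C₀ : ℝ≥0∞) * ENNReal.ofReal h)) := by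
        refine hG34.trans ?_
        have e1 : Real.exp (κ * (M ^ 2 * (3 * h / 4))) ≤ Real.exp (κ * (M ^ 2 * h)) :=
          Real.exp_le_exp.2 (mul_le_mul_of_nonneg_left
            (mul_le_mul_of_nonneg_left (by linarith) (sq_nonneg M)) hκ0)
        have e2 : (C₀ : ℝ≥0∞) * ENNReal.ofReal (3 * h / 4) ≤ (C₀ : ℝ≥0∞) * ENNReal.ofReal h :=
          mul_le_mul' le_rfl (ENNReal.ofReal_le_ofReal (by linarith))
        exact mul_le_mul' (ENNReal.ofReal_le_ofReal e1) (add_le_add le_rfl (mul_le_mul' le_rfl e2))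
      have ht1 : (((n + 1 : ℕ) : ℝ) * (h / 2)) = h / 2 + (n : ℝ) * (h / 2) := by push_cast; ring
      have hslice : u (((n + 1 : ℕ) : ℝ) * (h / 2)) = w (h / 2) := by
        rw [ht1, heq (h / 2) ⟨by linarith, by linarith⟩]
      refine ⟨fun m => ?_, ?_⟩
      · obtain ⟨C, hC⟩ := hwS m
        rw [hslice]
        exact (hC (h / 2) ⟨by linarith, by linarith⟩).trans_lt ENNReal.coe_lt_top
      · rw [hslice]
        refine hG.trans ?_
        rw [hw0]
        refine le_trans ?_ (loop_step_bound hκ0 hhpos.le K₀ bE n)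
        gcongr
  -- the first piece that reaches past `τ`
  have hex : ∃ n : ℕ, τ < (n : ℝ) * (h / 2) + h := by
    refine ⟨Nat.ceil (2 * τ / h) + 1, ?_⟩
    have h1 : 2 * τ / h ≤ (Nat.ceil (2 * τ / h) : ℝ) := Nat.le_ceil _
    have h2 : 2 * τ / h * (h / 2) = τ := by field_simp
    push_cast
    nlinarith
  set N := Nat.find hex with hN
  have hNspec : τ < (N : ℝ) * (h / 2) + h := Nat.find_spec hex
  have hNle : (N : ℝ) * (h / 2) + h / 2 ≤ τ := by
    rcases Nat.eq_zero_or_eq_succ_pred N with h0N | hsucc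
    · rw [h0N]; simp; linarith
    · have hmin : ¬ (τ < ((N - 1 : ℕ) : ℝ) * (h / 2) + h) := Nat.find_min hex (by omega)
      have hcast : (N : ℝ) = ((N - 1 : ℕ) : ℝ) + 1 := by
        rw [hsucc]; push_cast; simp
      rw [hcast]
      have hmin' := not_lt.1 hmin
      linarith
  set tN : ℝ := (N : ℝ) * (h / 2) with htN
  have htN0 : 0 ≤ tN := by positivity
  have htNτ : tN < τ := by linarith
  obtain ⟨hH, hens⟩ := loop N hNle
  have hnh : (N : ℝ) * h ≤ 2 * τ := by linarith
  obtain ⟨w, q, hw, hw0, hwS, hwS', hqS⟩ :=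
    piece tN htN0 htNτ hH (hens.trans (loop_bound_le_uniform hκ0 K₀ C₀ N hnh))
  exact ⟨h, tN, w, q, hhpos, htN0, hNle, hNspec, hw, hw0, hwS, pieceE hwS⟩

/-- **Extension past a half-open slab (forced, bounded).** GIVEN
`tao2011_smooth_local_existence_forced`: a classical solution `(u, p)` of the Navier–Stokes system
with viscosity `ν > 0` and a Clay-class force on `[0, τ) × ℝ³`, `τ > 0`, whose energy and velocity are
bounded uniformly on `[0, τ)` and whose datum `u 0` is Schwartz, has a classical finite-energy
extension `(U, P)` to a CLOSED slab `[0, T']`, `T' > τ`, with `U = u` on `[0, τ)`. Restart loop of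
file II run on closed sub-slabs of `[0, τ)` (the loop never reads `u(τ)`).
[cite: Tao2011, Thm. 5.4 (ii)+(iv)] [cite: LemarieRieusset2016, Thm. 11.2 (11.11)] -/
theorem exists_forced_extension_of_bounded_Ico (hF : tao2011_smooth_local_existence_forced)
    (hν : 0 < ν) (hτ : 0 < τ) (hs : IsSmoothOnHalfSpace f) (hd : HasRapidSpaceTimeDecay f)
    (hu : IsClassicalNSSolutionOn (Ico 0 τ) ν f u p)
    (hE : ∃ C : ℝ≥0∞, C < ⊤ ∧ ∀ t ∈ Ico 0 τ, ∫⁻ x, ‖u t x‖ₑ ^ 2 ≤ C)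
    (hM : ∀ t ∈ Ico 0 τ, ∀ x, ‖u t x‖ ≤ M) (h0 : HasRapidSpatialDecay (u 0)) :
    ∃ T' : ℝ, τ < T' ∧
      ∃ (U : ℝ → EuclideanSpace ℝ (Fin 3) → EuclideanSpace ℝ (Fin 3))
        (P : ℝ → EuclideanSpace ℝ (Fin 3) → ℝ),
        IsClassicalNSSolutionOn (Icc 0 T') ν f U P ∧
        (∀ t ∈ Ico 0 τ, U t = u t) ∧
        (∃ C : ℝ≥0∞, C < ⊤ ∧ ∀ t ∈ Icc 0 T', ∫⁻ x, ‖U t x‖ₑ ^ 2 ≤ C) := by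
  obtain ⟨E₀, hE₀, hEb⟩ := hE
  obtain ⟨h, tN, w, q, hhpos, htN0, hNle, hNspec, hw, hw0, hwS, hEw⟩ :=
    exists_last_piece_Ico hF hν hτ hs hd hu ⟨E₀, hE₀, hEb⟩ hM h0
  have huc : ∀ τ₁, 0 < τ₁ → τ₁ < τ → IsClassicalNSSolutionOn (Icc 0 τ₁) ν f u p := fun τ₁ h₁ h₂ =>
    hu.mono (fun t ht => ⟨ht.1, lt_of_le_of_lt ht.2 h₂⟩) (uniqueDiffOn_Icc h₁)
  have hEc : ∀ τ₁, τ₁ < τ → ∃ C : ℝ≥0∞, C < ⊤ ∧ ∀ t ∈ Icc 0 τ₁, ∫⁻ x, ‖u t x‖ₑ ^ 2 ≤ C :=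
    fun τ₁ h₂ => ⟨E₀, hE₀, fun t ht => hEb t ⟨ht.1, lt_of_le_of_lt ht.2 h₂⟩⟩
  have hMc : ∀ τ₁, τ₁ < τ → ∀ t ∈ Icc 0 τ₁, ∀ x, ‖u t x‖ ≤ M :=
    fun τ₁ h₂ t ht x => hM t ⟨ht.1, lt_of_le_of_lt ht.2 h₂⟩ x
  have htNτ : tN < τ := by linarith
  -- identification with the flow on the closed sub-slab `[tN, tN + h/4] ⊂ [0, τ)`, pressure matching
  have h14 : tN + h / 4 < τ := by linarith
  have heq : ∀ s ∈ Icc 0 (h / 4), w s = u (s + tN) :=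
    piece_eq_shift hν hs hd (huc _ (by linarith) h14) (hEc _ h14) (hMc _ h14) htN0 (by linarith)
      le_rfl (by linarith) hw hEw hw0
  obtain ⟨q', hw', hq'⟩ := IsClassicalNSSolutionOn.exists_pressure_eq_on_Icc
    (shift_classical (huc _ (by linarith) h14) htN0 (by linarith : 0 < h / 4) le_rfl) hw
    (by linarith : 0 < h / 4) (by linarith) heq
  -- shift the piece back to `[tN, tN + h]`
  set W : ℝ → EuclideanSpace ℝ (Fin 3) → EuclideanSpace ℝ (Fin 3) := fun t => w (t + -tN) with hW
  set Q : ℝ → EuclideanSpace ℝ (Fin 3) → ℝ := fun t => q' (t + -tN) with hQ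
  have hWsol : IsClassicalNSSolutionOn (Icc tN (tN + h)) ν f W Q := by
    have h1 := (hw'.comp_add_right (-tN)).mono (S' := Icc tN (tN + h))
      (fun t ht => ⟨by linarith [ht.1], by linarith [ht.2]⟩) (uniqueDiffOn_Icc (by linarith))
    refine ⟨h1.smooth_velocity, h1.smooth_pressure, fun t ht x => ?_, h1.divFree⟩
    have h2 := h1.momentum t ht x
    simp only [neg_add_cancel_right] at h2
    exact h2
  -- agreement with `(u, p)` on `[tN, tN + h/4]`
  have hagree : ∀ t ∈ Icc tN (tN + h / 4), u t = W t ∧ p t = Q t := by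
    intro t ht
    have hmem : t + -tN ∈ Icc 0 (h / 4) := ⟨by linarith [ht.1], by linarith [ht.2]⟩
    refine ⟨?_, ?_⟩
    · show u t = w (t + -tN)
      rw [heq _ hmem, neg_add_cancel_right]
    · show p t = q' (t + -tN)
      rw [hq' _ hmem, neg_add_cancel_right]
  -- velocity agreement on the whole of `[tN, τ)` (pointwise restart of the uniqueness)
  have hagreeU : ∀ t, tN < t → t < τ → W t = u t := by
    intro t ht1 ht2
    have hτ' : 0 < t + -tN := by linarith only [ht1]
    have hle : tN + (t + -tN) ≤ t := le_of_eq (by ring)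
    have hh' : t + -tN ≤ h := by linarith only [ht2, hNspec]
    have ht0 : 0 < t := lt_of_le_of_lt htN0 ht1
    have key : ∀ s ∈ Icc 0 (t + -tN), w s = u (s + tN) :=
      piece_eq_shift (τ := t) (t₀ := tN) (τ' := t + -tN) (T := h) hν hs hd (huc t ht0 ht2)
        (hEc t ht2) (hMc t ht2) htN0 hτ' hle hh' hw hEw hw0
    have key' := key (t + -tN) ⟨hτ'.le, le_rfl⟩
    show w (t + -tN) = u t
    rw [key', neg_add_cancel_right]
  -- glue along `(tN, tN + h/4)`
  set m : ℝ := tN + h / 8 with hm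
  have hglue := IsClassicalNSSolutionOn.glue_Icc (huc _ (by linarith) h14) hWsol htN0
    (by linarith : tN < m) (by linarith : m < tN + h / 4) (by linarith : tN + h / 4 ≤ tN + h)
    (fun t ht => hagree t ⟨ht.1.le, ht.2.le⟩)
  obtain ⟨Cw, hCwt, hCw⟩ := hEw
  refine ⟨tN + h, by linarith, _, _, hglue, fun t ht => ?_, ⟨max E₀ Cw, max_lt hE₀ hCwt, fun t ht => ?_⟩⟩
  · by_cases htm : t ≤ m
    · exact if_pos htm
    · simp only [if_neg htm]
      exact hagreeU t (by linarith) ht.2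
  · by_cases htm : t ≤ m
    · simp only [if_pos htm]
      exact (hEb t ⟨ht.1, by linarith⟩).trans (le_max_left _ _)
    · simp only [if_neg htm]
      show ∫⁻ x, ‖w (t + -tN) x‖ₑ ^ 2 ≤ max E₀ Cw
      exact (hCw (t + -tN) ⟨by linarith, by linarith [ht.2]⟩).trans (le_max_right _ _)

/-- **`HasSmoothExtensionPast` for bounded Clay-class solutions of the forced system**, GIVEN
`tao2011_smooth_local_existence_forced` (packaging of `exists_forced_extension_of_bounded_Ico`).
[cite: Tao2011, Thm. 5.4 (ii)+(iv)] -/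
theorem hasSmoothExtensionPast_of_bounded (hF : tao2011_smooth_local_existence_forced)
    (hν : 0 < ν) (hτ : 0 < τ) (hs : IsSmoothOnHalfSpace f) (hd : HasRapidSpaceTimeDecay f)
    (hu : IsClassicalNSSolutionOn (Ico 0 τ) ν f u p)
    (hE : ∃ C : ℝ≥0∞, C < ⊤ ∧ ∀ t ∈ Ico 0 τ, ∫⁻ x, ‖u t x‖ₑ ^ 2 ≤ C)
    (hM : ∀ t ∈ Ico 0 τ, ∀ x, ‖u t x‖ ≤ M) (h0 : HasRapidSpatialDecay (u 0)) :
    HasSmoothExtensionPast ν f u τ := by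
  obtain ⟨T', hT', U, P, hUP, hagree, -⟩ :=
    exists_forced_extension_of_bounded_Ico hF hν hτ hs hd hu hE hM h0
  exact ⟨T', hT', U, P, hUP.mono Ico_subset_Icc_self (uniqueDiffOn_Ico 0 T'), hagree⟩

/-- **The `L^∞` blow-up criterion WITH a Clay force, modulo Tao's forced local theory**: a MAXIMAL
classical solution on `[0, T)` (`IsMaximalSmoothSolution`: no classical extension past `T`) with
Schwartz datum, Clay-class force and energy bounded on `[0, T)` has unbounded velocity on
`[0, T) × ℝ³` — for every `M` some `(t, x)` with `t < T` and `M < ‖u(t, x)‖`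
(Lemarié-Rieusset 2016, Thm. 11.2 at `r = ∞` / Leray's criterion, classical Clay-class form).
[cite: LemarieRieusset2016, Thm. 11.2 (11.11)] [cite: BealeKatoMajda1984, §1] -/
theorem velocity_unbounded_of_maximal (hF : tao2011_smooth_local_existence_forced) {T : ℝ}
    (hν : 0 < ν) (hT : 0 < T) (hs : IsSmoothOnHalfSpace f) (hd : HasRapidSpaceTimeDecay f)
    (hmax : IsMaximalSmoothSolution ν f u p T)
    (hE : ∃ C : ℝ≥0∞, C < ⊤ ∧ ∀ t ∈ Ico 0 T, ∫⁻ x, ‖u t x‖ₑ ^ 2 ≤ C)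
    (h0 : HasRapidSpatialDecay (u 0)) :
    ∀ M : ℝ, ∃ t ∈ Ico 0 T, ∃ x, M < ‖u t x‖ := by
  intro M
  by_contra hcon
  have hb : ∀ t ∈ Ico 0 T, ∀ x, ‖u t x‖ ≤ M := fun t ht x =>
    not_lt.1 fun hlt => hcon ⟨t, ht, x, hlt⟩
  exact hmax.2 (hasSmoothExtensionPast_of_bounded hF hν hT hs hd hmax.1 hE hb h0)

end HalfOpen

end ForcedContinuation

end Summit.NavierStokesRegularity.FluidComputer.PalasekTowerClayBridge

end
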